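import Literature.Probability.RandomPlanarGeometry.ConformalRemovabilityProofs
import Mathlib.Analysis.Calculus.Deriv.CompMul
import HarnessLib

/-!
# Boundaries of Hölder domains are conformally removable inside EVERY open set (local Jones–Smirnov)

P. W. Jones, S. K. Smirnov, *Removability theorems for Sobolev functions and quasiconformal maps*,
Ark. Mat. 38 (2000) 263–279, Corollary 2 (p. 267): "Boundaries of Hölder domains are
quasiconformally removable". The tree's discharge `JonesSmirnov2000_frontier_of_isHolderDomain_holds`
(`ConformalRemovabilityProofs.lean`) proves removability of `∂Ω` inside open sets `U ⊇ ∂Ω`. This file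
proves the LOCAL form, with no containment hypothesis:

* `IsHolderDomain.isConformallyRemovableIn_frontier` — for a Hölder domain `Ω` and ANY open `U ⊆ ℂ`,
  every map continuous and injective on `U` and holomorphic on `U ∖ ∂Ω` is holomorphic on `U`
  (`IsConformallyRemovableIn U (frontier Ω)`).

This is what the paper's argument gives (the proof of Prop. 1, pp. 270–272, only involves Whitney
cubes whose shadows meet the segment and "only Whitney cubes of size at most `Δ` (which we can
choose to be arbitrarily small) are included", p. 272), and it is the form needed to transport
removability through conformal maps defined on `Ω`-side neighbourhoods only (SLE traces in a
domain: route `CriticalPhenomena/SAWWeldingIdentification`, item `SLERemovableChord`).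

## The proof

The analytic half `IsConformallyRemovableIn.of_twoPoint'` of the tree is already local in `U`. The
geometric half (`WhitneyTree.twoPoint_of_generic`, `ae_twoPoint_horizontal`) is re-run with two
changes: (i) the costs are attached to the ADMISSIBLE Whitney discs, those whose `11`-fold disc lies
in a fixed open set `O ⋐ U` of an exhaustion `O₀ ⊆ O₁ ⊆ ⋯` of `U` (so `Σ c² ≤ C · area F(O ∖ ∂Ω) < ∞`
and generic lines are chosen once for every level of the exhaustion); (ii) the finite exceptional set
`H₀` of the hub construction also contains the finitely many discs `v` with tail majorant
`τ(v) ≥ η` (`Σ τ² < ∞`), so that every `H₀`-free ray stays within `6η` of its landing point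
(`dist_ray_le`): rays landing near the segment only cross admissible discs, on which `F` is
holomorphic, and the partition/hub bookkeeping of the tree goes through verbatim with the hubs near
the segment.

## References

* [JonesSmirnov2000] P. W. Jones, S. K. Smirnov, Ark. Mat. 38 (2000) 263–279, Prop. 1 and its proof
  (pp. 270–272), Cor. 2 (p. 267).
-/

noncomputable section

open Set Metric MeasureTheory Filter Complex

open scoped NNReal ENNReal Topology

namespace Literature.Probability.RandomPlanarGeometry

variable {Ω : Set ℂ}

namespace WhitneyTree

variable (W : WhitneyTree Ω)

/-- **Bounded overlap of the dilated Whitney discs, for the cost integrals (admissible discs)**: if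
the discs `B(v, 11 r(v))`, `v ∈ A`, lie in a measurable set `O`, then
`Σ_{v ∈ A} ∫_{B(v, 11 r(v))} f ≤ (16·11+4)² ∫_O f`. [folklore] -/
theorem tsum_indicator_setLIntegral_ball_le_of_subset (hΩo : IsOpen Ω) (hΩc : Ωᶜ.Nonempty)
    {f : ℂ → ℝ≥0∞} (hf : AEMeasurable f) {O : Set ℂ} (hOm : MeasurableSet O) {A : Set W.S}
    (hsub : ∀ v : W.S, v ∈ A → ball (v : ℂ) (11 * (infDist (v : ℂ) Ωᶜ / 100)) ⊆ O) :
    ∑' v : W.S, A.indicator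
        (fun v => ∫⁻ w in ball (v : ℂ) (11 * (infDist (v : ℂ) Ωᶜ / 100)), f w) v ≤
      ENNReal.ofReal ((16 * 11 + 4) ^ 2) * ∫⁻ w in O, f w := by
  classical
  have h1 : ∀ v : W.S, A.indicator
      (fun v => ∫⁻ w in ball (v : ℂ) (11 * (infDist (v : ℂ) Ωᶜ / 100)), f w) v ≤
      ∫⁻ w in ball (v : ℂ) (11 * (infDist (v : ℂ) Ωᶜ / 100)), O.indicator f w := by
    intro v
    by_cases hv : v ∈ A
    · rw [Set.indicator_of_mem hv]
      exact setLIntegral_mono' measurableSet_ball fun w hw =>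
        (Set.indicator_of_mem (hsub v hv hw) f).ge
    · rw [Set.indicator_of_notMem hv]
      exact bot_le
  have h2 := Literature.Analysis.FluidPDE.tsum_setLIntegral_ball_le (volume : Measure ℂ)
    (lipschitzWith_infDist_div Ω) (M := 11) (by norm_num) (by norm_num) W.isWhitney.countable
    W.isWhitney.disjoint
    (fun x hx => div_pos (infDist_compl_pos hΩo hΩc (W.isWhitney.subset hx)) (by norm_num))
    (hf.indicator hOm)
  rw [Complex.finrank_real_complex] at h2
  calc ∑' v : W.S, A.indicator
        (fun v => ∫⁻ w in ball (v : ℂ) (11 * (infDist (v : ℂ) Ωᶜ / 100)), f w) v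
      ≤ ∑' v : W.S, ∫⁻ w in ball (v : ℂ) (11 * (infDist (v : ℂ) Ωᶜ / 100)), O.indicator f w :=
        ENNReal.tsum_le_tsum h1
    _ ≤ ENNReal.ofReal ((16 * 11 + 4) ^ 2) *
        ∫⁻ w in ⋃ x ∈ W.S, ball x (11 * (infDist x Ωᶜ / 100)), O.indicator f w := h2
    _ ≤ ENNReal.ofReal ((16 * 11 + 4) ^ 2) * ∫⁻ w, O.indicator f w := by
        gcongr
        exact Measure.restrict_le_self
    _ = ENNReal.ofReal ((16 * 11 + 4) ^ 2) * ∫⁻ w in O, f w := by rw [lintegral_indicator hOm]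

/-- The `11`-fold Whitney disc of a vertex lies in `Ω` (its radius is `11/100` of the distance to
the complement). [folklore] -/
theorem ball_eleven_subset (v : W.S) : ball (v : ℂ) (11 * (infDist (v : ℂ) Ωᶜ / 100)) ⊆ Ω := by
  refine (ball_subset_ball ?_).trans ball_infDist_compl_subset
  linarith [infDist_nonneg (x := (v : ℂ)) (s := Ωᶜ)]

/-- **The two-point estimate on a generic horizontal line, local form** (Jones–Smirnov 2000,
Prop. 1, estimate (10), planar conformal case, for `K = ∂Ω` of a Hölder domain, with `F` given on
an arbitrary open set `U`). The costs `c(v) = 4 (∫_{B(v, 11 r(v))} ‖F'‖ₑ²)^{1/2}` are attached to the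
admissible discs (`B(v, 11 r(v)) ⊆ O`, `O ⊆ U` fixed); `τ` bounds the tails of the rays and only
finitely many vertices have `τ ≥ η`; the line `Im z = y` is generic (`Σ_{v : |Im v - y| ≤ 6τ(v)} c(v) < ∞`);
and the segment `[u, u'] × {y}` has the margin `B(·, 30η) ⊆ O`. Then
`‖F(u' + iy) - F(u + iy)‖ ≤ ∫_u^{u'} ‖F'(t + iy)‖ dt`.
[cite: JonesSmirnov2000, Prop. 1 (pp. 270–272, estimate (10))] -/
theorem twoPoint_of_generic_local (φ : ConformalEquiv (ball (0 : ℂ) 1) Ω) {C α : ℝ≥0} (hα : 0 < α)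
    (hH : HolderOnWith C α φ (ball (0 : ℂ) 1)) {U O : Set ℂ} (hU : IsOpen U) (hOU : O ⊆ U)
    {F : ℂ → ℂ} (hFc : ContinuousOn F U) (hFd : DifferentiableOn ℂ F (U \ frontier Ω))
    {τ : W.S → ℝ} (hτr : ∀ v : W.S, infDist (v : ℂ) Ωᶜ / 100 ≤ τ v)
    (hτ : ∀ x : ℕ → W.S, (∀ n, W.parent (x (n + 1)) = x n) → (∀ n, x (n + 1) ≠ W.root) →
      ∀ k, ∑' n, infDist (x (k + n) : ℂ) Ωᶜ / 100 ≤ τ (x k))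
    {η : ℝ} (hη : 0 < η) (hfin : {v : W.S | η ≤ τ v}.Finite)
    {c : W.S → ℝ≥0∞} (hc : ∀ v, c v =
      {v : W.S | ball (v : ℂ) (11 * (infDist (v : ℂ) Ωᶜ / 100)) ⊆ O}.indicator
        (fun v => 4 * (∫⁻ w in ball (v : ℂ) (11 * (infDist (v : ℂ) Ωᶜ / 100)),
          ‖deriv F w‖ₑ ^ 2) ^ (1 / 2 : ℝ)) v)
    {y : ℝ} (hy : ∑' v, {v : W.S | |(v : ℂ).im - y| ≤ 6 * τ v}.indicator c v < ∞)
    {u u' : ℝ} (huu' : u ≤ u')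
    (hmargin : ∀ t ∈ Icc u u', ball ((t : ℂ) + y * I) (30 * η) ⊆ O)
    (hint : IntervalIntegrable (fun t : ℝ => deriv F (t + y * I)) volume u u')
    (huK : (u : ℂ) + y * I ∈ frontier Ω) (hu'K : (u' : ℂ) + y * I ∈ frontier Ω) :
    ‖F (u' + y * I) - F (u + y * I)‖ ≤ ∫ t in u..u', ‖deriv F (t + y * I)‖ := by
  classical
  have hΩo := isOpen_of_conformalEquiv_ball φ
  have hΩc : Ωᶜ.Nonempty := compl_nonempty_of_holderOnWith φ hH
  set K := frontier Ω with hK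
  have hKc : IsClosed K := isClosed_frontier
  set adm : Set W.S := {v : W.S | ball (v : ℂ) (11 * (infDist (v : ℂ) Ωᶜ / 100)) ⊆ O} with hadm
  set Rel : Set W.S := {v : W.S | |(v : ℂ).im - y| ≤ 6 * τ v} with hRel
  set f : ℝ → ℂ := fun t => F (t + y * I) with hf
  set g : ℝ → ℝ≥0∞ := fun t => ‖deriv F (t + y * I)‖ₑ with hg
  have hseg : ∀ t ∈ Icc u u', (t : ℂ) + y * I ∈ U := fun t ht =>
    hOU (hmargin t ht (mem_ball_self (by positivity)))
  -- admissible discs lie in `U \ K`; the edge estimate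
  have hballU : ∀ v : W.S, v ∈ adm → ball (v : ℂ) (11 * (infDist (v : ℂ) Ωᶜ / 100)) ⊆ U \ K := by
    intro v hv w hw
    refine ⟨hOU (hv hw), fun hwK => ?_⟩
    have : w ∈ Ω ∩ frontier Ω := ⟨W.ball_eleven_subset v hw, hwK⟩
    rw [hΩo.inter_frontier_eq] at this
    exact this
  have hedge : ∀ v : W.S, v ∈ adm → v ≠ W.root → ‖F (W.parent v) - F v‖ₑ ≤ c v := by
    intro v hv hvr
    rw [hc v, Set.indicator_of_mem hv]
    exact W.enorm_sub_parent_le hvr (infDist_compl_pos hΩo hΩc (W.isWhitney.subset v.2))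
      (hFd.mono (hballU v hv))
  -- continuity of `f` at points over `U`
  have hfcont : ∀ t : ℝ, (t : ℂ) + y * I ∈ U → ContinuousAt f t := fun t ht => by
    have h1 : ContinuousAt (fun t : ℝ => (t : ℂ) + y * I) t := by fun_prop
    show ContinuousAt (F ∘ fun t : ℝ => (t : ℂ) + y * I) t
    exact ContinuousAt.comp (hFc.continuousAt (hU.mem_nhds ht)) h1
  -- reduction to an estimate with an arbitrary error
  suffices key : ∀ ε : ℝ≥0∞, ε ≠ 0 → ‖f u' - f u‖ₑ ≤ (∫⁻ t in Ioc u u', g t) + 2 * ε by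
    have hlin : ∫⁻ t in Ioc u u', g t = ENNReal.ofReal (∫ t in u..u', ‖deriv F (t + y * I)‖) := by
      rw [intervalIntegral.integral_of_le huu', ofReal_integral_norm_eq_lintegral_enorm hint.1]
    have h1 : ‖f u' - f u‖ₑ ≤ ∫⁻ t in Ioc u u', g t := by
      refine ENNReal.le_of_forall_pos_le_add fun ε hε _ => ?_
      have h := key ((ε : ℝ≥0∞) / 2) (by simp [hε.ne'])
      rwa [ENNReal.mul_div_cancel (by norm_num) (by norm_num)] at h
    rw [hlin, ← ofReal_norm] at h1
    exact (ENNReal.ofReal_le_ofReal_iff (intervalIntegral.integral_nonneg huu'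
      fun t _ => norm_nonneg _)).1 h1
  intro ε hε
  -- (1) the finite set of expensive discs near the line, the discs with large tail, and `H₀`
  obtain ⟨Fε, hFε⟩ := exists_finset_tsum_indicator_compl_le hy.ne hε
  set H₀ : Finset W.S := Fε ∪ hfin.toFinset ∪ {W.root} with hH₀
  have hroot : W.root ∈ H₀ := by simp [hH₀]
  have hH₀τ : ∀ v, v ∉ H₀ → τ v < η := by
    intro v hv
    by_contra h
    exact hv (by simp [hH₀, hfin.mem_toFinset, not_lt.1 h])
  have hH₀F : ∀ v, v ∉ H₀ → v ∈ ((↑Fε : Set W.S)ᶜ) := by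
    intro v hv h
    exact hv (by simp [hH₀, Finset.mem_coe.1 h])
  have hH₀root : ∀ v, v ∉ H₀ → v ≠ W.root := by
    rintro v hv rfl
    exact hv hroot
  -- (1') rays avoiding `H₀` stay within `6η` of their landing point
  have hnear : ∀ x : ℕ → W.S, (∀ n, W.parent (x (n + 1)) = x n) → (∀ n, x (n + 1) ≠ W.root) →
      (∀ n, x n ∉ H₀) → ∀ {a : ℂ}, Tendsto (fun n => (x n : ℂ)) atTop (𝓝 a) →
      ∀ k, dist (x k : ℂ) a < 6 * η := by
    intro x hx hx0 hxH a ha k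
    have h1 := W.dist_ray_le φ hα hH hx hx0 ha k
    have h2 := hτ x hx hx0 k
    have h3 := hH₀τ _ (hxH k)
    linarith
  -- (2) subtrees, shadows on the line (rays from hubs near the segment), per-hub constants
  set Sub : W.S → Set W.S := fun h =>
    {w : W.S | ∃ m, W.parent^[m] w = h ∧ ∀ i ≤ m, W.parent^[i] w ∉ H₀} with hSub
  set A₀ : W.S → Set ℝ := fun h => {t : ℝ |
    (∃ t₀ ∈ Icc u u', dist (h : ℂ) ((t₀ : ℂ) + y * I) < 6 * η) ∧ ∃ x : ℕ → W.S, x 0 = h ∧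
    (∀ n, W.parent (x (n + 1)) = x n) ∧ (∀ n, x (n + 1) ≠ W.root) ∧ (∀ n, x n ∉ H₀) ∧
    Tendsto (fun n => (x n : ℂ)) atTop (𝓝 ((t : ℂ) + y * I))} with hA₀
  set Cst : W.S → ℝ≥0∞ := fun h => 2 * ∑' v, (Sub h ∩ Rel).indicator c v with hCst
  have hA₀K : ∀ h t, t ∈ A₀ h → (t : ℂ) + y * I ∈ K := by
    rintro h t ⟨-, x, -, hx, hx0, -, hxz⟩
    exact W.mem_frontier_of_ray φ hα hH hx hx0 hxz
  -- landing points of the rays of `A₀ h` carry an `18η`-disc inside `O`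
  have hA₀O : ∀ h t, t ∈ A₀ h → ball ((t : ℂ) + y * I) (18 * η) ⊆ O := by
    rintro h t ⟨⟨t₀, ht₀, hd₀⟩, x, hx0h, hx, hx0, hxH, hxz⟩ w hw
    refine hmargin t₀ ht₀ ?_
    have hd₁ : dist (h : ℂ) ((t : ℂ) + y * I) < 6 * η := by
      have := hnear x hx hx0 hxH hxz 0
      rwa [hx0h] at this
    rw [mem_ball] at hw ⊢
    calc dist w ((t₀ : ℂ) + y * I)
        ≤ dist w ((t : ℂ) + y * I) + dist ((t : ℂ) + y * I) ((t₀ : ℂ) + y * I) := dist_triangle _ _ _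
      _ ≤ dist w ((t : ℂ) + y * I) + (dist ((t : ℂ) + y * I) (h : ℂ) + dist (h : ℂ) ((t₀ : ℂ) + y * I)) :=
          add_le_add le_rfl (dist_triangle _ _ _)
      _ < 18 * η + (6 * η + 6 * η) := by
          rw [dist_comm ((t : ℂ) + y * I) (h : ℂ)]
          exact add_lt_add hw (add_lt_add hd₁ hd₀)
      _ = 30 * η := by ring
  have hA₀U : ∀ h t, t ∈ A₀ h → (t : ℂ) + y * I ∈ U := fun h t ht =>
    hOU (hA₀O h t ht (mem_ball_self (by positivity)))
  -- the segment as a compact set, and closure points of the shadows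
  set Sg : Set ℂ := (fun t : ℝ => (t : ℂ) + y * I) '' Icc u u' with hSg
  have hSgc : IsCompact Sg := isCompact_Icc.image (by fun_prop)
  have hSgne : Sg.Nonempty := ⟨(u : ℂ) + y * I, u, left_mem_Icc.2 huu', rfl⟩
  have hA₀sub : ∀ h, A₀ h ⊆ {t : ℝ | infDist ((t : ℂ) + y * I) Sg ≤ 12 * η} := by
    rintro h t ⟨⟨t₀, ht₀, hd₀⟩, x, hx0h, hx, hx0, hxH, hxz⟩
    have hd₁ : dist (h : ℂ) ((t : ℂ) + y * I) < 6 * η := by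
      have := hnear x hx hx0 hxH hxz 0
      rwa [hx0h] at this
    show infDist ((t : ℂ) + y * I) Sg ≤ 12 * η
    calc infDist ((t : ℂ) + y * I) Sg ≤ dist ((t : ℂ) + y * I) ((t₀ : ℂ) + y * I) :=
          infDist_le_dist_of_mem ⟨t₀, ht₀, rfl⟩
      _ ≤ dist ((t : ℂ) + y * I) (h : ℂ) + dist (h : ℂ) ((t₀ : ℂ) + y * I) := dist_triangle _ _ _
      _ ≤ 12 * η := by
          rw [dist_comm ((t : ℂ) + y * I) (h : ℂ)]
          linarith
  have hclU : ∀ h, ∀ s ∈ closure (A₀ h), (s : ℂ) + y * I ∈ U := by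
    intro h s hs
    have hcl : IsClosed {t : ℝ | infDist ((t : ℂ) + y * I) Sg ≤ 12 * η} :=
      isClosed_le ((continuous_infDist_pt Sg).comp (by fun_prop)) continuous_const
    have hs' : infDist ((s : ℂ) + y * I) Sg ≤ 12 * η :=
      closure_minimal (hA₀sub h) hcl hs
    obtain ⟨a₀, ha₀, hda₀⟩ := hSgc.exists_infDist_eq_dist hSgne ((s : ℂ) + y * I)
    obtain ⟨t₀, ht₀, rfl⟩ := ha₀
    refine hOU (hmargin t₀ ht₀ ?_)
    rw [mem_ball, ← hda₀]
    linarith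
  have hAK : ∀ h t, t ∈ closure (A₀ h) → (t : ℂ) + y * I ∈ K := by
    intro h
    have hcl : IsClosed {t : ℝ | (t : ℂ) + y * I ∈ K} :=
      hKc.preimage (continuous_ofReal.add continuous_const)
    exact fun t ht => closure_minimal (fun s hs => hA₀K h s hs) hcl ht
  -- (3) the chain estimate along a ray from a hub
  have hray : ∀ h t, t ∈ A₀ h → ‖F h - f t‖ₑ ≤ ∑' v, (Sub h ∩ Rel).indicator c v := by
    intro h t ht
    have hO18 := hA₀O h t ht
    obtain ⟨-, x, hx0h, hx, hx0, hxH, hxz⟩ := ht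
    have hadm' : ∀ n, x n ∈ adm := by
      intro n w hw
      refine hO18 ?_
      have h1 : dist (x n : ℂ) ((t : ℂ) + y * I) < 6 * η := hnear x hx hx0 hxH hxz n
      have h2 : infDist (x n : ℂ) Ωᶜ / 100 < η := (hτr (x n)).trans_lt (hH₀τ _ (hxH n))
      rw [mem_ball] at hw ⊢
      calc dist w ((t : ℂ) + y * I) ≤ dist w (x n : ℂ) + dist (x n : ℂ) ((t : ℂ) + y * I) :=
            dist_triangle _ _ _
        _ < 11 * η + 6 * η := add_lt_add (hw.trans_le (by linarith)) h1
        _ ≤ 18 * η := by linarith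
    have hedge' : ∀ n, ‖F (x n) - F (x (n + 1))‖ₑ ≤ c (x (n + 1)) := fun n => by
      rw [← hx n]
      exact hedge _ (hadm' _) (hx0 n)
    have hT : ∀ n, x (n + 1) ∈ Sub h ∩ Rel := fun n =>
      ⟨W.ray_mem_subtree hx0h hx hxH (n + 1), by
        have := W.abs_im_sub_le_of_ray φ hα hH hτ hx hx0 hxz (n + 1)
        simpa [hRel] using this⟩
    have hFz : Tendsto (fun n => F (x n)) atTop (𝓝 (F ((t : ℂ) + y * I))) := by
      have htU : (t : ℂ) + y * I ∈ U := hOU (hO18 (mem_ball_self (by positivity)))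
      have hcw : ContinuousWithinAt F U ((t : ℂ) + y * I) := hFc _ htU
      refine hcw.tendsto.comp (tendsto_nhdsWithin_iff.2 ⟨hxz, Eventually.of_forall fun n => ?_⟩)
      exact (hballU _ (hadm' n) (mem_ball_self (by
        have := infDist_compl_pos hΩo hΩc (W.isWhitney.subset (x n).2); positivity))).1
    have := W.enorm_sub_le_tsum_indicator_of_ray hx hx0 hedge' hT hFz
    rwa [hx0h] at this
  -- (4) oscillation on the closed shadows
  have htri : ∀ a b e : ℂ, ‖a - b‖ₑ ≤ ‖e - a‖ₑ + ‖e - b‖ₑ := fun a b e => by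
    have := edist_triangle_left a b e
    simpa only [edist_eq_enorm_sub] using this
  have hC₀ : ∀ h, ∀ s ∈ A₀ h, ∀ t ∈ A₀ h, ‖f t - f s‖ₑ ≤ Cst h := by
    intro h s hs t ht
    calc ‖f t - f s‖ₑ ≤ ‖F h - f t‖ₑ + ‖F h - f s‖ₑ := htri _ _ _
      _ ≤ (∑' v, (Sub h ∩ Rel).indicator c v) + ∑' v, (Sub h ∩ Rel).indicator c v :=
          add_le_add (hray h t ht) (hray h s hs)
      _ = Cst h := by simp only [hCst]; ring
  have hC : ∀ h, ∀ s ∈ closure (A₀ h), ∀ t ∈ closure (A₀ h), ‖f t - f s‖ₑ ≤ Cst h := by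
    intro h s hs t ht
    obtain ⟨sq, hsq, hsql⟩ := mem_closure_iff_seq_limit.1 hs
    obtain ⟨tq, htq, htql⟩ := mem_closure_iff_seq_limit.1 ht
    have hfs : Tendsto (fun k => f (sq k)) atTop (𝓝 (f s)) :=
      (hfcont s (hclU h s hs)).tendsto.comp hsql
    have hft : Tendsto (fun k => f (tq k)) atTop (𝓝 (f t)) :=
      (hfcont t (hclU h t ht)).tendsto.comp htql
    have hlim : Tendsto (fun k => ‖f (tq k) - f (sq k)‖ₑ) atTop (𝓝 ‖f t - f s‖ₑ) :=
      (hft.sub hfs).enorm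
    exact le_of_tendsto' hlim fun k => hC₀ h _ (hsq k) _ (htq k)
  -- (5) the gap estimate (fundamental theorem of calculus off `K`)
  set Kl : Set ℝ := {t : ℝ | t ∈ Icc u u' ∧ (t : ℂ) + y * I ∈ K} with hKl
  have hKlc : IsClosed Kl := isClosed_Icc.inter (hKc.preimage (continuous_ofReal.add continuous_const))
  have hgap : ∀ a b, a ≤ b → a ∈ Kl → b ∈ Kl → (∀ t ∈ Ioo a b, t ∉ Kl) →
      ‖f b - f a‖ₑ ≤ ∫⁻ t in Ioc a b, g t := by
    intro a b hab ha hb hno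
    have hsub : Icc a b ⊆ Icc u u' := Icc_subset_Icc ha.1.1 hb.1.2
    have hcont : ContinuousOn f (Icc a b) := fun t ht =>
      (hfcont t (hseg t (hsub ht))).continuousWithinAt
    have hderiv : ∀ t ∈ Ioo a b, HasDerivAt f (deriv F (t + y * I)) t := by
      intro t ht
      have htI : t ∈ Icc u u' := hsub (Ioo_subset_Icc_self ht)
      have htK : (t : ℂ) + y * I ∉ K := fun h => hno t ht ⟨htI, h⟩
      have htU : (t : ℂ) + y * I ∈ U \ K := ⟨hseg t htI, htK⟩
      have hFt : HasDerivAt F (deriv F (t + y * I)) (t + y * I) :=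
        (hFd.differentiableAt ((hU.sdiff hKc).mem_nhds htU)).hasDerivAt
      exact (HasDerivAt.comp_add_const (t : ℂ) (y * I) hFt).comp_ofReal
    have hint' : IntervalIntegrable (fun t : ℝ => deriv F (t + y * I)) volume a b := by
      refine hint.mono_set ?_
      rw [uIcc_of_le huu', uIcc_of_le hab]
      exact hsub
    have hftc := intervalIntegral.integral_eq_sub_of_hasDerivAt_of_le hab hcont hderiv hint'
    have h1 : ‖f b - f a‖ ≤ ∫ t in a..b, ‖deriv F (t + y * I)‖ := by
      rw [← hftc]
      exact intervalIntegral.norm_integral_le_integral_norm hab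
    calc ‖f b - f a‖ₑ = ENNReal.ofReal ‖f b - f a‖ := (ofReal_norm _).symm
      _ ≤ ENNReal.ofReal (∫ t in a..b, ‖deriv F (t + y * I)‖) := ENNReal.ofReal_le_ofReal h1
      _ = ∫⁻ t in Ioc a b, g t := by
          rw [intervalIntegral.integral_of_le hab, ofReal_integral_norm_eq_lintegral_enorm hint'.1]
  -- (6) the hubs form a finite set covering `Kl`
  have hHubs : {h : W.S | h ∉ H₀ ∧ W.parent h ∈ H₀}.Finite := by
    refine (H₀.finite_toSet.biUnion fun p _ => W.finite_children p).subset ?_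
    rintro h ⟨hh, hp⟩
    exact mem_iUnion₂.2 ⟨W.parent h, Finset.mem_coe.2 hp, rfl, hH₀root h hh⟩
  set Hubs : Finset W.S := hHubs.toFinset with hHubsdef
  have hcov : ∀ t ∈ Kl, u ≤ t → ∃ h ∈ Hubs, t ∈ closure (A₀ h) := by
    rintro t ⟨htI, htK⟩ -
    obtain ⟨x, hx0r, hx, hx0, hxz⟩ := W.exists_ray_tendsto_of_mem_frontier φ hα hH htK
    obtain ⟨h, yv, hhH, hph, hy0, hyv, hyv0, hyH, hyz⟩ :=
      W.exists_hub_of_ray hroot hx0r hx hx0 hxz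
    have hmem : h ∈ Hubs := hHubs.mem_toFinset.2 ⟨hhH, hph⟩
    have hd : dist (h : ℂ) ((t : ℂ) + y * I) < 6 * η := by
      have := hnear yv hyv hyv0 hyH hyz 0
      rwa [hy0] at this
    have htA : t ∈ A₀ h := ⟨⟨t, htI, hd⟩, yv, hy0, hyv, hyv0, hyH, hyz⟩
    exact ⟨h, hmem, subset_closure htA⟩
  -- (7) the partition lemma
  have main := enorm_sub_le_lintegral_add_sum (f := f) (g := g) hKlc (u' := u')
    ⟨right_mem_Icc.2 huu', hu'K⟩ (fun t ht => ht.1.2) (A := fun h => closure (A₀ h))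
    (fun h => isClosed_closure) (C := Cst) hC hgap Hubs (u := u) ⟨left_mem_Icc.2 huu', huK⟩ hcov
  -- (8) the hubs' subtrees are disjoint: the total is `≤ 2ε`
  have hmemSub : ∀ h v, v ∈ Sub h → v ∉ H₀ := by
    rintro h v ⟨m, -, hm⟩
    simpa using hm 0 (Nat.zero_le _)
  have hpt : ∀ v, ∑ h ∈ Hubs, (Sub h ∩ Rel).indicator c v ≤
      ((↑Fε : Set W.S)ᶜ).indicator (Rel.indicator c) v := by
    intro v
    by_cases hv : ∃ h ∈ Hubs, v ∈ Sub h
    · obtain ⟨h, hh, hvh⟩ := hv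
      rw [Finset.sum_eq_single_of_mem h hh]
      · by_cases hvR : v ∈ Rel
        · rw [Set.indicator_of_mem (show v ∈ Sub h ∩ Rel from ⟨hvh, hvR⟩),
            Set.indicator_of_mem (hH₀F v (hmemSub h v hvh)), Set.indicator_of_mem hvR]
        · rw [Set.indicator_of_notMem (show v ∉ Sub h ∩ Rel from fun h' => hvR h'.2)]
          exact bot_le
      · intro h' hh' hne
        refine Set.indicator_of_notMem (fun hv' => hne ?_) _
        obtain ⟨m, hm, hmH⟩ := hv'.1
        obtain ⟨m', hm', hm'H⟩ := hvh
        have h1 := (hHubs.mem_toFinset.1 hh').2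
        have h2 := (hHubs.mem_toFinset.1 hh).2
        exact W.subtree_disjoint h1 h2 hm hmH hm' hm'H
    · push Not at hv
      rw [Finset.sum_eq_zero fun h hh => Set.indicator_of_notMem (fun hv' => hv h hh hv'.1) _]
      exact bot_le
  have hsum : ∑ h ∈ Hubs, Cst h ≤ 2 * ε := by
    simp only [hCst]
    rw [← Finset.mul_sum]
    gcongr
    calc ∑ h ∈ Hubs, ∑' v, (Sub h ∩ Rel).indicator c v
        = ∑' v, ∑ h ∈ Hubs, (Sub h ∩ Rel).indicator c v :=
          (Summable.tsum_finsetSum fun _ _ => ENNReal.summable).symm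
      _ ≤ ∑' v, ((↑Fε : Set W.S)ᶜ).indicator (Rel.indicator c) v := ENNReal.tsum_le_tsum hpt
      _ ≤ ε := hFε
  calc ‖f u' - f u‖ₑ ≤ (∫⁻ t in Ioc u u', g t) + ∑ h ∈ Hubs, Cst h := main
    _ ≤ (∫⁻ t in Ioc u u', g t) + 2 * ε := add_le_add le_rfl hsum

end WhitneyTree

/-! ### Almost every horizontal line, local form -/

/-- For a square-summable family, only finitely many terms exceed a given positive level. [folklore] -/
theorem finite_setOf_le_of_summable_sq {V : Type*} {τ : V → ℝ}
    (hτs : Summable fun v => τ v ^ 2) {η : ℝ} (hη : 0 < η) : {v : V | η ≤ τ v}.Finite := by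
  have h1 := hτs.tendsto_cofinite_zero
  have h2 : ∀ᶠ v in cofinite, τ v ^ 2 < η ^ 2 := h1 (Iio_mem_nhds (by positivity))
  refine (Filter.eventually_cofinite.1 h2).subset fun v hv => ?_
  have hv' : η ≤ τ v := hv
  simp only [mem_setOf_eq, not_lt]
  exact pow_le_pow_left₀ hη.le hv' 2

/-- **The two-point estimate on almost every horizontal line, local form** (Jones–Smirnov 2000,
Prop. 1, planar conformal case, `F` given on an arbitrary open set `U`): for the boundary `∂Ω` of a
Hölder domain, `F` continuous and injective on `U` and holomorphic on `U ∖ ∂Ω`, for a.e. `y`: for all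
boundary points `u + iy`, `u' + iy` (`u ≤ u'`) whose segment lies in `U` and on which `F'` is
integrable, `‖F(u' + iy) - F(u + iy)‖ ≤ ∫_u^{u'} ‖F'(t + iy)‖ dt`.
[cite: JonesSmirnov2000, Prop. 1 (pp. 270–272)] -/
theorem ae_twoPoint_horizontal_local (φ : ConformalEquiv (ball (0 : ℂ) 1) Ω) {C α : ℝ≥0}
    (hα : 0 < α) (hH : HolderOnWith C α φ (ball (0 : ℂ) 1)) {U : Set ℂ} (hU : IsOpen U)
    {F : ℂ → ℂ} (hFc : ContinuousOn F U) (hFi : InjOn F U)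
    (hFd : DifferentiableOn ℂ F (U \ frontier Ω)) :
    ∀ᵐ y : ℝ, ∀ u u' : ℝ, u ≤ u' → (∀ t ∈ Icc u u', (t : ℂ) + y * I ∈ U) →
      IntervalIntegrable (fun t : ℝ => deriv F (t + y * I)) volume u u' →
      (u : ℂ) + y * I ∈ frontier Ω → (u' : ℂ) + y * I ∈ frontier Ω →
      ‖F (u' + y * I) - F (u + y * I)‖ ≤ ∫ t in u..u', ‖deriv F (t + y * I)‖ := by
  classical
  obtain ⟨W⟩ := WhitneyTree.nonempty_of_holderOnWith φ hα hH
  have hΩo := isOpen_of_conformalEquiv_ball φ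
  have hΩc : Ωᶜ.Nonempty := compl_nonempty_of_holderOnWith φ hH
  set K := frontier Ω with hK
  obtain ⟨τ, hτ0, hτr, hτ, hτs⟩ := W.exists_tau φ hα hH
  haveI : Countable W.S := W.isWhitney.countable.to_subtype
  -- an exhaustion of `U` by open sets with compact closure in `U`
  set O : ℕ → Set ℂ := fun n => ball (0 : ℂ) (n + 1) \ cthickening (1 / (n + 1 : ℝ)) Uᶜ with hO
  have hOopen : ∀ n, IsOpen (O n) := fun n => isOpen_ball.sdiff isClosed_cthickening
  have hOU : ∀ n, O n ⊆ U := fun n z hz => by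
    by_contra hzU
    exact hz.2 (self_subset_cthickening _ hzU)
  set Cn : ℕ → Set ℂ := fun n =>
    closedBall (0 : ℂ) (n + 1) ∩ {z | ENNReal.ofReal (1 / (n + 1 : ℝ)) ≤ Metric.infEDist z Uᶜ} with hCn
  have hCcpt : ∀ n, IsCompact (Cn n) := fun n =>
    (isCompact_closedBall (0 : ℂ) _).inter_right
      (isClosed_le continuous_const Metric.continuous_infEDist)
  have hCU : ∀ n, Cn n ⊆ U := fun n z hz => by
    by_contra hzU
    have h0 : Metric.infEDist z Uᶜ = 0 := Metric.infEDist_zero_of_mem hzU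
    have h1 := hz.2
    rw [mem_setOf_eq, h0, nonpos_iff_eq_zero, ENNReal.ofReal_eq_zero] at h1
    have : (0 : ℝ) < 1 / (n + 1 : ℝ) := by positivity
    linarith
  have hOC : ∀ n, O n ⊆ Cn n := fun n z hz =>
    ⟨ball_subset_closedBall hz.1, by
      have h2 := hz.2
      rw [Metric.mem_cthickening_iff, not_le] at h2
      exact h2.le⟩
  -- the costs of the admissible discs at level `n`, square summable
  set J : W.S → ℝ≥0∞ := fun v =>
    ∫⁻ w in ball (v : ℂ) (11 * (infDist (v : ℂ) Ωᶜ / 100)), ‖deriv F w‖ₑ ^ 2 with hJ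
  set adm : ℕ → Set W.S := fun n =>
    {v : W.S | ball (v : ℂ) (11 * (infDist (v : ℂ) Ωᶜ / 100)) ⊆ O n} with hadm
  set c : ℕ → W.S → ℝ≥0∞ := fun n => (adm n).indicator fun v => 4 * J v ^ (1 / 2 : ℝ) with hc
  have hc2 : ∀ n, ∑' v, c n v ^ 2 ≠ ∞ := by
    intro n
    have h1 : ∀ v, c n v ^ 2 = 16 * (adm n).indicator J v := by
      intro v
      by_cases hv : v ∈ adm n
      · simp only [hc, Set.indicator_of_mem hv]
        have h2 : (J v ^ (1 / 2 : ℝ)) ^ (2 : ℕ) = J v := by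
          rw [← ENNReal.rpow_natCast, ← ENNReal.rpow_mul]
          norm_num
        rw [mul_pow, h2]
        norm_num
      · simp only [hc, Set.indicator_of_notMem hv]
        simp
    simp_rw [h1]
    rw [ENNReal.tsum_mul_left]
    have hO' : IsOpen (O n \ K) := (hOopen n).sdiff isClosed_frontier
    have hsub : ∀ v : W.S, v ∈ adm n →
        ball (v : ℂ) (11 * (infDist (v : ℂ) Ωᶜ / 100)) ⊆ O n \ K := by
      intro v hv w hw
      refine ⟨hv hw, fun hwK => ?_⟩
      have : w ∈ Ω ∩ frontier Ω := ⟨W.ball_eleven_subset v hw, hwK⟩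
      rw [hΩo.inter_frontier_eq] at this
      exact this
    refine ENNReal.mul_ne_top (by norm_num) (ne_top_of_le_ne_top ?_
      (W.tsum_indicator_setLIntegral_ball_le_of_subset hΩo hΩc
        ((measurable_deriv F).enorm.pow_const 2).aemeasurable hO'.measurableSet hsub))
    rw [lintegral_enorm_deriv_sq_eq_volume_image hO' (hFd.mono fun z hz => ⟨hOU n hz.1, hz.2⟩)
      (hFi.mono fun z hz => hOU n hz.1)]
    refine ENNReal.mul_ne_top ENNReal.ofReal_ne_top ?_
    have hcpt : IsCompact (F '' Cn n) := (hCcpt n).image_of_continuousOn (hFc.mono (hCU n))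
    exact ne_top_of_le_ne_top hcpt.measure_lt_top.ne
      (measure_mono (image_mono fun z hz => hOC n hz.1))
  -- generic lines, for every level at once
  have hgen : ∀ᵐ y : ℝ, ∀ n, ∑' v, {v : W.S | |(v : ℂ).im - y| ≤ 6 * τ v}.indicator (c n) v < ∞ := by
    rw [ae_all_iff]
    exact fun n => ae_tsum_indicator_lt_top (fun v : W.S => (v : ℂ).im) hτ0 hτs (hc2 n)
  filter_upwards [hgen] with y hy
  intro u u' huu' hseg hint huK hu'K
  -- the segment, its distance to `Uᶜ`, and the level `n`
  set Sg : Set ℂ := (fun t : ℝ => (t : ℂ) + y * I) '' Icc u u' with hSg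
  have hSgc : IsCompact Sg := isCompact_Icc.image (by fun_prop)
  have hSgU : Sg ⊆ U := by
    rintro _ ⟨t, ht, rfl⟩
    exact hseg t ht
  obtain ⟨δ, hδ, hδU⟩ := hSgc.exists_cthickening_subset_open hU hSgU
  obtain ⟨R, hR⟩ := hSgc.isBounded.subset_ball (0 : ℂ)
  obtain ⟨n, hn⟩ := exists_nat_gt (max R (4 / δ))
  have hnR : R < n := (le_max_left _ _).trans_lt hn
  have hnδ : 4 / δ < n := (le_max_right _ _).trans_lt hn
  have hn1 : (0 : ℝ) < (n : ℝ) + 1 := by positivity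
  have hδn : 1 / ((n : ℝ) + 1) < δ / 4 := by
    rw [div_lt_iff₀ hδ] at hnδ
    rw [div_lt_div_iff₀ hn1 (by norm_num : (0 : ℝ) < 4)]
    nlinarith
  set η : ℝ := 1 / (60 * ((n : ℝ) + 1)) with hη
  have hη0 : 0 < η := by positivity
  have hη30 : 30 * η = 1 / (2 * ((n : ℝ) + 1)) := by
    simp only [hη]
    field_simp
    ring
  have hη30' : 30 * η < δ / 8 := by
    rw [hη30]
    have : 1 / (2 * ((n : ℝ) + 1)) = (1 / ((n : ℝ) + 1)) / 2 := by
      field_simp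
    rw [this]
    linarith
  have hη30'' : 30 * η ≤ 1 / 2 := by
    rw [hη30, div_le_div_iff₀ (by positivity) (by norm_num : (0 : ℝ) < 2)]
    have : (0 : ℝ) ≤ n := n.cast_nonneg
    linarith
  -- the margin `B(a, 30η) ⊆ O n` along the segment
  have hmargin : ∀ t ∈ Icc u u', ball ((t : ℂ) + y * I) (30 * η) ⊆ O n := by
    intro t ht w hw
    have haS : (t : ℂ) + y * I ∈ Sg := ⟨t, ht, rfl⟩
    rw [mem_ball] at hw
    refine ⟨?_, ?_⟩
    · have h1 : (t : ℂ) + y * I ∈ ball (0 : ℂ) R := hR haS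
      rw [mem_ball] at h1 ⊢
      calc dist w 0 ≤ dist w ((t : ℂ) + y * I) + dist ((t : ℂ) + y * I) 0 := dist_triangle _ _ _
        _ < 30 * η + R := add_lt_add hw h1
        _ ≤ (n : ℝ) + 1 := by linarith
    · intro hwc
      rw [Metric.mem_cthickening_iff] at hwc
      -- every point of `Uᶜ` is `δ`-far from the segment, hence `> δ/2`-far from `w`
      have hfar : ENNReal.ofReal (δ / 2) ≤ Metric.infEDist w Uᶜ := by
        refine Metric.le_infEDist.2 fun p hp => ?_
        have hpS : δ < dist p ((t : ℂ) + y * I) := by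
          by_contra hle
          exact hp (hδU (Metric.mem_cthickening_of_dist_le p ((t : ℂ) + y * I) δ Sg haS
            (not_lt.1 hle)))
        rw [edist_dist]
        refine ENNReal.ofReal_le_ofReal ?_
        have := dist_triangle p w ((t : ℂ) + y * I)
        rw [dist_comm p w] at this
        linarith
      have h3 : ENNReal.ofReal (δ / 2) ≤ ENNReal.ofReal (1 / ((n : ℝ) + 1)) := hfar.trans hwc
      rw [ENNReal.ofReal_le_ofReal_iff (by positivity)] at h3
      linarith
  exact W.twoPoint_of_generic_local φ hα hH hU (hOU n) hFc hFd hτr hτ hη0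
    (finite_setOf_le_of_summable_sq hτs hη0) (c := c n) (fun v => rfl) (hy n) huu' hmargin
    hint huK hu'K

/-- **The two-point estimate on almost every vertical line, local form**, from the horizontal one
applied to `F ∘ (i ·)` on the rotated Hölder domain. [cite: JonesSmirnov2000, Prop. 1 (pp. 270–272)] -/
theorem ae_twoPoint_vertical_local (φ : ConformalEquiv (ball (0 : ℂ) 1) Ω) {C α : ℝ≥0} (hα : 0 < α)
    (hH : HolderOnWith C α φ (ball (0 : ℂ) 1)) {U : Set ℂ} (hU : IsOpen U)
    {F : ℂ → ℂ} (hFc : ContinuousOn F U) (hFi : InjOn F U)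
    (hFd : DifferentiableOn ℂ F (U \ frontier Ω)) :
    ∀ᵐ x : ℝ, ∀ y y' : ℝ, y ≤ y' → (∀ t ∈ Icc y y', (x : ℂ) + t * I ∈ U) →
      IntervalIntegrable (fun t : ℝ => deriv F (x + t * I)) volume y y' →
      (x : ℂ) + y * I ∈ frontier Ω → (x : ℂ) + y' * I ∈ frontier Ω →
      ‖F (x + y' * I) - F (x + y * I)‖ ≤ ∫ t in y..y', ‖deriv F (x + t * I)‖ := by
  set ρ : ℂ → ℂ := fun w => I * w with hρ
  set Ω' : Set ℂ := ρ ⁻¹' Ω with hΩ'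
  set U' : Set ℂ := ρ ⁻¹' U with hU'
  obtain ⟨ψ, hψ⟩ : ∃ ψ : ConformalEquiv (ball (0 : ℂ) 1) Ω', HolderOnWith C α ψ (ball (0 : ℂ) 1) :=
    exists_conformalEquiv_preimage_mul_I φ hH
  have hρc : Continuous ρ := continuous_const_mul I
  have hfr : frontier Ω' = ρ ⁻¹' frontier Ω :=
    ((Homeomorph.mulLeft₀ I I_ne_zero).preimage_frontier Ω).symm
  have hU'o : IsOpen U' := hU.preimage hρc
  set G : ℂ → ℂ := F ∘ ρ with hG
  have hGc : ContinuousOn G U' := hFc.comp hρc.continuousOn fun w hw => hw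
  have hGi : InjOn G U' := hFi.comp (fun a _ b _ h => mul_left_cancel₀ I_ne_zero h) fun w hw => hw
  have hGd : DifferentiableOn ℂ G (U' \ frontier Ω') := by
    rw [hfr]
    exact hFd.comp (differentiableOn_id.const_mul I) fun w hw => hw
  have h := ae_twoPoint_horizontal_local ψ hα hψ hU'o hGc hGi hGd
  have h' := (Measure.measurePreserving_neg (volume : Measure ℝ)).quasiMeasurePreserving.ae h
  filter_upwards [h'] with x hx
  intro y y' hyy' hseg hint hyK hy'K
  have hconv : ∀ t : ℝ, ρ ((t : ℂ) + ((-x : ℝ) : ℂ) * I) = (x : ℂ) + (t : ℂ) * I := fun t => by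
    simp only [hρ]
    rw [I_mul_ofReal_add_ofReal_mul_I, neg_neg]
  have hderiv : ∀ t : ℝ, deriv G ((t : ℂ) + ((-x : ℝ) : ℂ) * I) =
      I * deriv F ((x : ℂ) + (t : ℂ) * I) := by
    intro t
    have := deriv_comp_mul_left I F ((t : ℂ) + ((-x : ℝ) : ℂ) * I)
    rw [smul_eq_mul] at this
    rw [← hconv t]
    exact this
  have hx' := hx y y' hyy' (fun t ht => by
      show ρ ((t : ℂ) + ((-x : ℝ) : ℂ) * I) ∈ U
      rw [hconv t]
      exact hseg t ht)
    (by
      have : (fun t : ℝ => deriv G ((t : ℂ) + ((-x : ℝ) : ℂ) * I)) =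
          fun t : ℝ => I * deriv F ((x : ℂ) + (t : ℂ) * I) := funext hderiv
      rw [this]
      exact hint.const_mul I)
    (by rw [hfr]; show ρ _ ∈ frontier Ω; rw [hconv]; exact hyK)
    (by rw [hfr]; show ρ _ ∈ frontier Ω; rw [hconv]; exact hy'K)
  have e1 : G ((y' : ℂ) + ((-x : ℝ) : ℂ) * I) = F ((x : ℂ) + (y' : ℂ) * I) := by
    show F (ρ _) = _
    rw [hconv]
  have e2 : G ((y : ℂ) + ((-x : ℝ) : ℂ) * I) = F ((x : ℂ) + (y : ℂ) * I) := by
    show F (ρ _) = _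
    rw [hconv]
  have e3 : ∫ t in y..y', ‖deriv G ((t : ℂ) + ((-x : ℝ) : ℂ) * I)‖ =
      ∫ t in y..y', ‖deriv F ((x : ℂ) + (t : ℂ) * I)‖ := by
    refine intervalIntegral.integral_congr fun t _ => ?_
    simp only [hderiv, norm_mul, norm_I, one_mul]
  rw [e1, e2, e3] at hx'
  exact hx'

/-! ### The theorem -/

/-- **Jones–Smirnov 2000, Corollary 2, local form: the boundary of a Hölder domain is conformally
removable inside every open set.** For a Hölder domain `Ω` and any open `U ⊆ ℂ`, every map
continuous and injective on `U` and holomorphic on `U ∖ ∂Ω` is holomorphic on `U`. (No hypothesis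
`∂Ω ⊆ U`; cf. the tree's `JonesSmirnov2000_frontier_of_isHolderDomain_holds`.)
[cite: JonesSmirnov2000, Cor. 2 (p. 267) with Prop. 1 (pp. 270–272)] -/
theorem IsHolderDomain.isConformallyRemovableIn_frontier (hΩ : IsHolderDomain Ω) {U : Set ℂ}
    (hU : IsOpen U) : IsConformallyRemovableIn U (frontier Ω) := by
  obtain ⟨φ, C, α, hα, hH⟩ := hΩ
  refine IsConformallyRemovableIn.of_twoPoint' hU isClosed_frontier
    (volume_frontier_eq_zero_of_holderOnWith φ hα hH) fun F hFc hFi hFd => ⟨?_, ?_⟩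
  · filter_upwards [ae_twoPoint_horizontal_local φ hα hH hU hFc hFi hFd] with y hy
    intro _ x x' hxx' hseg hint hxK hx'K
    exact hy x x' hxx' hseg hint hxK hx'K
  · filter_upwards [ae_twoPoint_vertical_local φ hα hH hU hFc hFi hFd] with x hx
    intro _ y y' hyy' hseg hint hyK hy'K
    exact hx y y' hyy' hseg hint hyK hy'K

end Literature.Probability.RandomPlanarGeometry
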